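import Summits.BirchSwinnertonDyer.BirchSwinnertonDyer.Theorems.ByReductionTypeAtTwoOrdKatoHalfAtTwoIsoGreenbergMuNegDefs
import Summits.BirchSwinnertonDyer.BirchSwinnertonDyer.Theorems.ByReductionTypeAtTwoOrdKatoHalfAtTwoIsoPosDiscNecessity
import Summits.BirchSwinnertonDyer.BirchSwinnertonDyer.Theorems.ByReductionTypeAtTwoOrdKatoHalfAtTwoIsoGreenbergMuDefs
import Summits.BirchSwinnertonDyer.BirchSwinnertonDyer.Theorems.ByReductionTypeAtTwoOrdKatoHalfAtTwoIsoHintOfAbbesUllmo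
import Summits.BirchSwinnertonDyer.Rank1Residual.X5.KatoOrdTwoMuPart
import Literature.NumberTheory.EllipticCurves.NonEisensteinPrimeOfSurjective
import Literature.NumberTheory.EllipticCurves.IsogenyIdProofs
import Literature.Uncategorized.OrdPublishedInputsAtTwo
import HarnessLib

/-!
# Vet48f — crux-triage r1 seat 1, GEN 48 addendum 2: BY-NAME VET (built-modules-only variant of Vet48e) of w3 GEN 7's landed split (p735706 defs + p736704 doors,
# ACCEPTED 18:02Z) against the REGISTERED v24 stub `stub_muFreeValue_negDisc_two` (skeleton 4921f2ec, signature_norm 1 229 ch).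

(V1) the landed G11⁻ def `GreenbergMuZeroTwoOrdNegDisc` is `Iff.rfl` to the text this seat certified in `Cert48d.G11NegText`;
(V2) DEFERRED to a build of p736704's module (rc 75 unbuilt ×2): by TEXT READING the landed iff's LHS (file l. 210–225) is the REGISTERED
     signature character for character (same 25 binders, same two hypotheses, same `∃ g, IsEulerSystemClassTwo W hκ I g ∧ col (I.loc J hsurj hγ hγᵥ g) ∉ (2)`);
(V3) the ROUTE DECL `OrdKatoHalfAtTwoIso` BY NAME from {G11⁺ (p733065), G11⁻ (p735706), PUB, AU, the not-onto cell} — sign-free direct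
     road on the onto cell (p736704's `ordKatoHalfAtTwoIso_negDisc_of_greenbergMuNeg` INLINED — its module is unbuilt —; the three O1 doors, both signs), i.e. F-48d
     by LANDED names: on the onto cell MU13⁻ / PT / the functional are NOT on the crux's critical path.
BSD is not proved; the crux is not proved; everything is conditional on the displayed hypotheses.
-/

set_option autoImplicit false
set_option linter.dupNamespace false

noncomputable section

open scoped Classical MatrixGroups ModularForm NumberField
open CongruenceSubgroup WeierstrassCurve Field IsDedekindDomain NumberField
open Literature.NumberTheory.GaloisRepresentations
open Literature.NumberTheory.GaloisCohomology
open Literature.NumberTheory.EllipticCurves Literature.NumberTheory.EllipticCurves.ModularForms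
  Literature.NumberTheory.EllipticCurves.GreenbergSelmer
open Literature.NumberTheory.EllipticCurves.Kato2004
  Literature.NumberTheory.EllipticCurves.Kato2004.EulerSystemValues
open Literature.NumberTheory.EllipticCurves.IwasawaDual
open Literature.NumberTheory.EllipticCurves.Rank1Residual
open Literature.NumberTheory.EllipticCurves.Greenberg1999
open Summit.BirchSwinnertonDyer.Rank1Residual Summit.BirchSwinnertonDyer.Rank1Residual.X5
open Summit.BirchSwinnertonDyer.BirchSwinnertonDyer.Theorems.SteinbergFibreAtTwo
open Summit.BirchSwinnertonDyer.BirchSwinnertonDyer.Theses.ByReductionTypeAtTwo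

namespace Summit.BirchSwinnertonDyer.BirchSwinnertonDyer.Cruxes.OrdKatoHalfAtTwoIso.TriageVet48f

/-- (V1) landed G11⁻ ≡ `Cert48d.G11NegText` (text pasted). [cite: GreenbergLNM1716, Conj. 1.11 (p. 64)] -/
example : GreenbergMuZeroTwoOrdNegDisc ↔
    (∀ (W : WeierstrassCurve ℚ) [W.IsElliptic] [W.IsGloballyMinimal],
      GoodOrd W 2 → W.HasSurjectiveModNGaloisRep 2 → W.Δ < 0 →
      ∀ (κ : ZpExtension ℚ 2) (γ : absoluteGaloisGroup ℚ), κ.IsCyclotomic → κ.IsTopGenerator γ → IsCyclotomicVariable 2 γ →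
        ∀ D : W.SelmerDualData κ γ, D.mu = 0) :=
  Iff.rfl

/-- The REGISTERED v24 text of `stub_muFreeValue_negDisc_two` (ledger signature, verbatim). -/
def RegisteredVflatNeg : Prop :=
  ∀ (W : WeierstrassCurve ℚ) [W.IsElliptic] [W.IsGloballyMinimal] [ContinuousSMul ℤ_[2] (W.tateModule 2)] [Module.Free ℤ_[2] (W.tateModule 2)] [Module.Finite ℤ_[2] (W.tateModule 2)] {N : ℕ} [NeZero N] (f : CuspForm (Gamma0 N) 2) (κ : ZpExtension ℚ 2) (γ : absoluteGaloisGroup ℚ) (hκ : κ.IsCyclotomic) (hγ : κ.IsTopGenerator γ), W.Δ < 0 → IsOrdinaryAt W 2 → W.HasSurjectiveModNGaloisRep 2 → IsCyclotomicVariable 2 γ → IsNewformOf W f → ∀ (v₂ : HeightOneSpectrum (𝓞 ℚ)) (_ : ((2 : ℕ) : 𝓞 ℚ) ∈ v₂.asIdeal) (γᵥ : absoluteGaloisGroup (v₂.adicCompletion ℚ)) (hsurj : Function.Surjective (κ.toContinuousMonoidHom.comp (resGalOfEmb (closureEmb (K := ℚ) (v₂.adicCompletion ℚ))))) (hγᵥ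 : κ.IsTopGenerator (resGalOfEmb (closureEmb (K := ℚ) (v₂.adicCompletion ℚ)) γᵥ)) (I : IwasawaH1Data W 2 κ γ) (J : LocalIwasawaH1Data κ v₂ ((tateRep W 2).toLocal v₂) γᵥ) (J' : LocalIwasawaH1Data κ v₂ (tateLocalOrdinaryRep W 2 v₂) γᵥ) (col : J.H →ₗ[IwasawaAlgebra 2] IwasawaAlgebra 2), (∀ x : J.H, col x = 0 ↔ x ∈ LinearMap.range (J'.ordinaryInclusion J)) → (∃ x : J.H, col x ∉ IwasawaAlgebra.augIdealP 2) → ∃ g : I.H, IsEulerSystemClassTwo W hκ I g ∧ col (I.loc J hsurj hγ hγᵥ g) ∉ IwasawaAlgebra.augIdealP 2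

/-- (V2-text) the registered text ELABORATES here and its `∃ g, IsEulerSystemClassTwo … ∧ col (I.loc …) ∉ (2)` conclusion is the shape
split by p736704 (by-name `exact` against `muFreeValue_negDisc_iff_greenbergMuNeg_and_zetaQuotientMu` deferred: module UNBUILT on the farm
scratch nodes at 18:07Z / 18:10Z, rc 75 `remote:stale:10106:unbuilt`). -/
example : RegisteredVflatNeg ↔ RegisteredVflatNeg := Iff.rfl

/-- The crux restricted to the NOT-onto cell (23921's road; displayed). -/
def CruxNotOntoText : Prop :=
  ∀ (W : WeierstrassCurve ℚ) [W.IsElliptic] [W.IsGloballyMinimal], ¬ W.HasCM → W.analyticRank = 0 → GoodOrd W 2 →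
    ¬ W.HasSurjectiveModNGaloisRep 2 →
    ∃ (W' : WeierstrassCurve ℚ) (_ : W'.IsElliptic) (_ : W'.IsGloballyMinimal),
      IsIsogenous W W' ∧ O1.MainConjectureLowerDivisibilityAtTwoOrd W'

/-- (V3) **the ROUTE DECL BY NAME from {G11⁺, G11⁻} (both LANDED defs) + PUB + AU + the not-onto cell** — F-48d by landed names:
no MU13⁻, no Poitou–Tate, no functional, no Euler system on the crux's critical path over the onto cell.
[cite: GreenbergLNM1716, Conj. 1.11 (p. 64)] [cite: Kato2004Asterisque, Thm. 17.4 (1)(2) (p. 273)] [cite: AbbesUllmo1996, Thm. A] -/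
theorem crux_of_g11Pos_g11Neg_landed (hP : GreenbergMuZeroTwoOrdPosDisc) (hN : GreenbergMuZeroTwoOrdNegDisc)
    (hPub : OrdPublishedInputsAtTwo) (hAU : abbesUllmo_not_dvd_maninConstant_of_not_dvd_level)
    (hno : CruxNotOntoText) : OrdKatoHalfAtTwoIso := by
  obtain ⟨-, -, h17, -⟩ := hPub
  intro W _ _ hcm hr hgo
  by_cases h2 : W.HasSurjectiveModNGaloisRep 2
  · rcases lt_trichotomy W.Δ 0 with hΔ | hΔ | hΔ
    · haveI : NeZero ((2 : ℕ) : ℚ) := ⟨by norm_num⟩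
      exact ⟨W, ‹_›, ‹_›, isIsogenous_self W,
        O1.mainConjectureLowerDivisibilityAtTwoOrd_of_katoMuPartAtTwo W (h17 W)
          (fun f hf ϖ hϖ => hint_two_of_abbesUllmo_of_irr hAU W hgo
            (hasIrreducibleModPGaloisRep_of_hasSurjectiveModNGaloisRep W 2 h2) f hf ϖ hϖ)
          (O1.katoMuPartAtTwo_of_mu_eq_zero W (fun κ γ hκ hγ hγ' D => hN W hgo h2 hΔ κ γ hκ hγ hγ' D))⟩
    · exact absurd hΔ W.isUnit_Δ.ne_zero
    · haveI : NeZero ((2 : ℕ) : ℚ) := ⟨by norm_num⟩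
      exact ⟨W, ‹_›, ‹_›, isIsogenous_self W,
        O1.mainConjectureLowerDivisibilityAtTwoOrd_of_katoMuPartAtTwo W (h17 W)
          (fun f hf ϖ hϖ => hint_two_of_abbesUllmo_of_irr hAU W hgo
            (hasIrreducibleModPGaloisRep_of_hasSurjectiveModNGaloisRep W 2 h2) f hf ϖ hϖ)
          (O1.katoMuPartAtTwo_of_mu_eq_zero W (hP W hcm hr hgo h2 hΔ))⟩
  · exact hno W hcm hr hgo h2

end Summit.BirchSwinnertonDyer.BirchSwinnertonDyer.Cruxes.OrdKatoHalfAtTwoIso.TriageVet48f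

end
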